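import Summits.Langlands.Langlands.Theses.TameDarkSplit

/-!
# TameDarkSplit — glue of the layer-1 split (k = 2) of `WildDarkAutomorphy` (SDT)

Closes the glue item stmt-Langlands-33895
`TameDarkSplit.WildDarkAutomorphy_of_visibilitysplit : VisibleDarkAutomorphy → InvisibleDarkAutomorphy → WildDarkAutomorphy`
(route-Langlands-TameDarkSplit rev 1; lens-3-g11 node `VisibilitySplit`, crit-1 g4 row 145).  Pure logic: one excluded middle on the
inlined PAD clause («some host move datum has a 𝔭-adically automorphic avatar»), written with `Classical.byContradiction` so that the dial
is never restated, and ORDER-FREE in the antecedents (`intro h1 h2; apply … <;> assumption`).  Plus the exactness statement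
SDT ↔ VDK ∧ IDK.  This is the PROOF section of nodes/lens-3-g11-VisibilitySplit.split_glue.lean verbatim (mock block dropped; the
completed-cohomology import now comes through the route file).  No definitions, no new mathematics.
-/

set_option linter.dupNamespace false -- project-wide option; `Summit.Langlands.Langlands` is the mandated namespace

namespace Summit.Langlands.Langlands.Theorems

open Summit.Langlands.Langlands.Theses.TameDarkSplit in
/-- The two children give back the parent: one excluded middle on the PAD clause
(«some host move datum has a 𝔭-adically automorphic avatar»).  No mathematics. -/
theorem WildDarkAutomorphy_of_visible_of_invisible
    (hV : VisibleDarkAutomorphy) (hI : InvisibleDarkAutomorphy) : WildDarkAutomorphy :=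
  fun K _ _ hK n hcpt hn ℓ _ ι ρ hirr hgeo hW hT =>
    Classical.byContradiction fun hno =>
      hno (hI K hK n hcpt hn ℓ ι ρ hirr hgeo hW hT fun hP => hno (hV K hK n hcpt hn ℓ ι ρ hirr hgeo hW hT hP))

open Summit.Langlands.Langlands.Theses.TameDarkSplit in
/-- The glue item of the lens-3-g11 split of SDT 33249.  ORDER-FREE (census-1 rule, bus L697): works whether the gate renders the
antecedents as `VisibleDarkAutomorphy → InvisibleDarkAutomorphy → WildDarkAutomorphy` or in the reverse order. -/
theorem WildDarkAutomorphy_of_visibilitysplit_proof : WildDarkAutomorphy_of_visibilitysplit := by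
  intro h1 h2
  apply WildDarkAutomorphy_of_visible_of_invisible <;> assumption

open Summit.Langlands.Langlands.Theses.TameDarkSplit in
/-- Exactness of the split: the parent is literally the conjunction of the two children. -/
theorem WildDarkAutomorphy_split_exact :
    WildDarkAutomorphy ↔ VisibleDarkAutomorphy ∧ InvisibleDarkAutomorphy :=
  ⟨fun h => ⟨fun K _ _ hK n hcpt hn ℓ _ ι ρ hirr hgeo hW hT _ => h K hK n hcpt hn ℓ ι ρ hirr hgeo hW hT,
             fun K _ _ hK n hcpt hn ℓ _ ι ρ hirr hgeo hW hT _ => h K hK n hcpt hn ℓ ι ρ hirr hgeo hW hT⟩,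
   fun h => WildDarkAutomorphy_of_visible_of_invisible h.1 h.2⟩


end Summit.Langlands.Langlands.Theorems
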